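import Mathlib
import Summits.SmoothPoincare4.SmoothPoincare4.Theorems.ShadowsStandard.Negative.TwistAbsorption
import Summits.SmoothPoincare4.SmoothPoincare4.Theorems.WaldhausenPairs.Negative.PairTransferFalse
import Summits.SmoothPoincare4.SmoothPoincare4.Theorems.WaldhausenPairs.Negative.StandardPairSymmetries

/-!
# Negative lemmas for the crux `ShadowsStandard` (item stmt-SmoothPoincare4-14593), VI:
# load-bearing analysis of the MOD-`e` GATE `PowerTwistGate` (line `power-twist-absorption`)

Refuter file (drefute seats `…-14593-0` (gen 1: the `e = 2` witnesses) and `…-14593-g2-0` (gen 2: every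
exponent `e ≥ 2`, the fallback gate, divisibility)); pure group theory. Notions from `TwistAbsorption.lean`.

* §4 the levels `M_e = ⋂ ker (S₃ →* ℤ/e)` (characteristic, all `e`-th powers inside) and two `ℤ/e`-characters.
* §5 **LOAD-BEARING at every exponent.** For EVERY `e ≥ 2` (not only the calibration `e = 2`):
  (N1) `not_trivialGoeritzAt` — the strengthening "no Goeritz factor" (`y = 1`, i.e. `K₂ ∈ Mod_g[e]·C·N₂`) is
  FALSE at `(m,e) = (0,e)`, witness `K = T₀ • N`, `T₀ = dehnEquiv 0` (the twist about `a₁ ∈ N₀ ∩ N₁`, an element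
  of `A ∩ B` acting TRIVIALLY on both free faces `S/N₀`, `S/N₁`): modulo `M_e` the factor `t` dies and the
  `ℤ/e`-character `a₁ ↦ −1, b₁ ↦ 1` kills `T₀N₂ = ⟪b₁a₁, a₂, a₃⟫` but not `b₁ ∈ N₂`;
  (N2) `not_withoutNormalisationAt` — dropping `K₀ = N₀ ∧ K₁ = N₁` is FALSE at every `e ≥ 2` (witness the
  relabelled standard triple `N ∘ finRotate 3`); (N3) `not_withoutTrisectionAt` — dropping `IsGroupTrisection`
  is FALSE at every `e` (witness `K₂ = ⊥`); (N8) `not_congruenceGateTrivialGoeritz` — even the line's weaker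
  FALLBACK gate (the skeleton's `CongruenceGate`: `t` any `M`-congruent automorphism) needs the exact Goeritz factor.
  Corollaries: the `∀ m e` forms `not_forall_trivialGoeritzAt`, `not_forall_withoutNormalisationAt`,
  `not_forall_withoutTrisectionAt`. (All statements inline or parametrised by `(m,e)`; no closed `Prop` is introduced.)
* §6 structure: (N4) dropping the twist factor `t` is EXACTLY normalised unstable standardness
  (`trivialTwistAt_iff_normalisedUnstableStandardAt`) and `NormalisedUnstableStandardAt m → GateAt m e` (so a
  counterexample to the gate is a normalised balanced group trisection of `{1}` not isomorphic to the standard one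
  — an exotic homotopy 4-sphere or a non-standard balanced trisection of `S⁴`; none is certified); (N5)
  `powerTwists m 0 = ⊥`; (N6) the handlebody factor `c` is decoration (`gateAt_iff_noHandlebodyFactorAt`);
  (N7) inner automorphisms stabilise all `Nᵢ` (the gate lives in `Out S`); (N9, in `TwistAbsorption.lean`) divisibility
  monotonicity `gateAt_of_dvd`: the gate at exponent `e` implies it at every divisor of `e`.
-/

noncomputable section

namespace Summit.SmoothPoincare4.SmoothPoincare4.Theorems.ShadowsStandard.Negative.PowerTwist

open Literature.Topology.FourManifolds Subgroup
open Summit.SmoothPoincare4.SmoothPoincare4.Theorems.WaldhausenPairs.Negative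
  (dehnEquiv dehnEquiv_a dehnEquiv_b_of_ne dehnEquiv_b_self map_dehnZero_s4Kernels_zero
    map_dehnZero_s4Kernels_one)

/-! ## §4 The levels `M_e = ⋂ ker (S₃ →* ℤ/e)` and `ℤ/e`-characters at genus 3 -/

/-- Every element of `ℤ/e` (written multiplicatively) has `e`-th power `1` (also for `e = 0`). [folklore] -/
theorem zmod_pow_self (e : ℕ) (x : Multiplicative (ZMod e)) : x ^ e = 1 := by
  rw [← ofAdd_toAdd x, ← ofAdd_nsmul, nsmul_eq_mul, ZMod.natCast_self, zero_mul, ofAdd_zero]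

/-- The level `M_e = ⋂ ker (S₃ →* ℤ/e)` (`= [S,S]·Sᵉ`), a characteristic subgroup of `S₃ = Sg 0`. [folklore] -/
abbrev Me (e : ℕ) : Subgroup (Sg 0) := levelSubgroup 3 (Multiplicative (ZMod e))

/-- [folklore] -/
theorem pow_mem_Me (e : ℕ) (s : Sg 0) : s ^ e ∈ Me e := by
  refine Subgroup.mem_iInf.2 fun φ => ?_
  rw [MonoidHom.mem_ker, map_pow, zmod_pow_self]

/-- [folklore] -/
theorem Me_characteristic (e : ℕ) : (Me e).Characteristic := levelSubgroup_characteristic 3 _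

/-- Modulo `M_e` every element of `powerTwists 0 e` is congruent to the identity. [folklore] -/
theorem congruentMod_Me_of_mem_powerTwists {e : ℕ} {t : Sg 0 ≃* Sg 0} (ht : t ∈ powerTwists 0 e) :
    CongruentMod (Me e) t :=
  twistAbsorption 0 e (Me e) (Me_characteristic e) (pow_mem_Me e) t ht

/-- The `ℤ/e`-character of handle `0` used in (N1): `a₁ ↦ −1`, `b₁ ↦ 1`, other generators `↦ 0`
(additive notation); it kills the twisted meridian `b₁a₁`. [folklore] -/
def twistChar (e : ℕ) : Sg 0 →* Multiplicative (ZMod e) :=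
  abelianHom fun x : surfaceGen 3 =>
    if x = ((0 : Fin 3), true) then Multiplicative.ofAdd (1 : ZMod e)
    else if x = ((0 : Fin 3), false) then Multiplicative.ofAdd (-1 : ZMod e) else 1

/-- The `ℤ/e`-character `b₁ ↦ 1`, other generators `↦ 0`, used in (N2). [folklore] -/
def bChar (e : ℕ) : Sg 0 →* Multiplicative (ZMod e) :=
  abelianHom fun x : surfaceGen 3 =>
    if x = ((0 : Fin 3), true) then Multiplicative.ofAdd (1 : ZMod e) else 1

/-- [folklore] -/
theorem twistChar_b0 (e : ℕ) :
    twistChar e (SurfaceGroup.b 0) = Multiplicative.ofAdd (1 : ZMod e) := by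
  simp [twistChar, SurfaceGroup.b]

/-- [folklore] -/
theorem twistChar_a0 (e : ℕ) :
    twistChar e (SurfaceGroup.a 0) = Multiplicative.ofAdd (-1 : ZMod e) := by
  simp [twistChar, SurfaceGroup.a]

/-- [folklore] -/
theorem twistChar_a_of_ne (e : ℕ) {i : Fin 3} (hi : i ≠ 0) : twistChar e (SurfaceGroup.a i) = 1 := by
  simp [twistChar, SurfaceGroup.a, hi]

/-- [folklore] -/
theorem bChar_b0 (e : ℕ) : bChar e (SurfaceGroup.b 0) = Multiplicative.ofAdd (1 : ZMod e) := by
  simp [bChar, SurfaceGroup.b]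

/-- [folklore] -/
theorem bChar_a (e : ℕ) (i : Fin 3) : bChar e (SurfaceGroup.a i) = 1 := by
  simp [bChar, SurfaceGroup.a]

/-- [folklore] -/
theorem bChar_b_of_ne (e : ℕ) {i : Fin 3} (hi : i ≠ 0) : bChar e (SurfaceGroup.b i) = 1 := by
  simp [bChar, SurfaceGroup.b, hi]

/-- For `e ≥ 2`, `1 ≠ 0` in `ℤ/e`, so `b₁` survives both characters. [folklore] -/
theorem ofAdd_one_ne_one {e : ℕ} (he : 2 ≤ e) : Multiplicative.ofAdd (1 : ZMod e) ≠ 1 := by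
  haveI : Fact (1 < e) := ⟨he⟩
  rw [Ne, ofAdd_eq_one]
  exact one_ne_zero

/-- `b₁ ∈ N₂ = s4Kernels 2`. [folklore] -/
theorem b0_mem_N2 : (SurfaceGroup.b 0 : Sg 0) ∈ N 0 2 :=
  of_mem_s4Kernels 2 (x := ((0 : Fin 3), true)) (by decide)

/-- The twisted third kernel `T₀(N₂) = ⟪b₁a₁, a₂, a₃⟫` dies under `twistChar e`. [folklore] -/
theorem map_dehnZero_N2_le_ker_twistChar (e : ℕ) :
    (s4Kernels 2).map (dehnEquiv 0).toMonoidHom ≤ (twistChar e).ker := by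
  rw [Subgroup.map_le_iff_le_comap, s4Kernels_eq]
  refine Subgroup.normalClosure_le_normal ?_
  rintro _ ⟨x, hx, rfl⟩
  rw [SetLike.mem_coe, Subgroup.mem_comap, MonoidHom.mem_ker]
  simp only [s4Gens, Finset.coe_insert, Finset.coe_singleton, Matrix.cons_val_two,
    Matrix.tail_cons, Matrix.head_cons, Set.mem_insert_iff, Set.mem_singleton_iff] at hx
  rcases hx with rfl | rfl | rfl
  · change twistChar e (dehnEquiv 0 (SurfaceGroup.b 0)) = 1
    rw [dehnEquiv_b_self, map_mul, twistChar_b0, twistChar_a0, ← ofAdd_add, add_neg_cancel, ofAdd_zero]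
  · change twistChar e (dehnEquiv 0 (SurfaceGroup.a 1)) = 1
    rw [dehnEquiv_a, twistChar_a_of_ne e (by decide)]
  · change twistChar e (dehnEquiv 0 (SurfaceGroup.a 2)) = 1
    rw [dehnEquiv_a, twistChar_a_of_ne e (by decide)]

/-- `N₀ = ⟪a₁, a₂, b₃⟫` dies under `bChar e`. [folklore] -/
theorem N0_le_ker_bChar (e : ℕ) : N 0 0 ≤ (bChar e).ker := by
  change s4Kernels 0 ≤ (bChar e).ker
  rw [s4Kernels_eq]
  refine Subgroup.normalClosure_le_normal ?_
  rintro _ ⟨x, hx, rfl⟩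
  rw [SetLike.mem_coe, MonoidHom.mem_ker]
  simp only [s4Gens, Finset.coe_insert, Finset.coe_singleton, Matrix.cons_val_zero,
    Set.mem_insert_iff, Set.mem_singleton_iff] at hx
  rcases hx with rfl | rfl | rfl
  · exact bChar_a e 0
  · exact bChar_a e 1
  · exact bChar_b_of_ne e (by decide)

/-! ## §5 LOAD-BEARING at every exponent `e ≥ 2` -/

/-- Natural strengthening of the gate at `(m,e)`: NO Goeritz factor (`y = 1`): `K₂ ∈ Mod_g[e]·C·N₂`. [folklore] -/
def TrivialGoeritzAt (m e : ℕ) : Prop :=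
  ∀ K : TrisectionKernels (3 + 3 * m),
    IsGroupTrisection (3 + 3 * m) (m + 1) (PUnit : Type) K → K 0 = N m 0 → K 1 = N m 1 →
    ∃ t c : Sg m ≃* Sg m,
      t ∈ powerTwists m e ∧ (N m 2).map c.toMonoidHom = N m 2 ∧
      K 2 = ((N m 2).map c.toMonoidHom).map t.toMonoidHom

/-- The twisted standard triple `T₀ • N`, `T₀ = dehnEquiv 0` (twist about `a₁ ∈ N₀ ∩ N₁`): a `(3;1)` group
trisection of `{1}` with standard spine `(N₀, N₁)` and third kernel `⟪b₁a₁, a₂, a₃⟫`. [folklore] -/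
def twistedKernels : TrisectionKernels 3 := fun i => (s4Kernels i).map (dehnEquiv 0).toMonoidHom

/-- [folklore] -/
theorem twistedKernels_isGroupTrisection : IsGroupTrisection 3 1 (PUnit : Type) twistedKernels :=
  Summit.SmoothPoincare4.SmoothPoincare4.Theorems.WaldhausenPairs.Negative.IsGroupTrisection.map_mulEquiv
    s4Kernels_isGroupTrisection_holds (dehnEquiv 0)

/-- [folklore] -/
theorem twistedKernels_zero : twistedKernels 0 = N 0 0 := map_dehnZero_s4Kernels_zero
/-- [folklore] -/
theorem twistedKernels_one : twistedKernels 1 = N 0 1 := map_dehnZero_s4Kernels_one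

/-- **(N1) The exact Goeritz factor is load-bearing at EVERY exponent `e ≥ 2`.** At `(m,e) = (0,e)` the
strengthening `y = 1` fails on `K = T₀ • N`: modulo `M_e` it would give `T₀N₂ · M_e = N₂ · M_e`
(`sup_eq_map_of_factorisation`), but `twistChar e` kills the left side and not `b₁ ∈ N₂`. So
`Mod₃[e]`-moves and `H₂`-handlebody moves never generate the Goeritz element, at any level `e`; note that the
witness `T₀ ∈ A ∩ B` acts trivially on both free faces `S/N₀`, `S/N₁` (it twists along a curve in
`N₀ ∩ N₁`). [folklore] -/
theorem not_trivialGoeritzAt {e : ℕ} (he : 2 ≤ e) : ¬ TrivialGoeritzAt 0 e := by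
  intro h
  obtain ⟨t, c, ht, hc, hK2⟩ :=
    h twistedKernels twistedKernels_isGroupTrisection twistedKernels_zero twistedKernels_one
  have key : twistedKernels 2 ⊔ Me e = (N 0 2 ⊔ Me e).map (MulEquiv.refl (Sg 0)).toMonoidHom := by
    refine sup_eq_map_of_factorisation (Me_characteristic e) (pow_mem_Me e) ht hc ?_
    rw [hK2]
    exact (Subgroup.map_id _).symm
  have key' : twistedKernels 2 ⊔ Me e = N 0 2 ⊔ Me e := by
    rw [key]; exact Subgroup.map_id _
  have hle : twistedKernels 2 ⊔ Me e ≤ (twistChar e).ker :=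
    sup_le (map_dehnZero_N2_le_ker_twistChar e) (levelSubgroup_le_ker _)
  rw [key'] at hle
  have hb := hle (Subgroup.mem_sup_left b0_mem_N2)
  rw [MonoidHom.mem_ker, twistChar_b0] at hb
  exact ofAdd_one_ne_one he hb

/-- The gate at `(m,e)` WITHOUT the normalisation `K₀ = N₀ ∧ K₁ = N₁`. [folklore] -/
def WithoutNormalisationAt (m e : ℕ) : Prop :=
  ∀ K : TrisectionKernels (3 + 3 * m),
    IsGroupTrisection (3 + 3 * m) (m + 1) (PUnit : Type) K →
    ∃ y t c : Sg m ≃* Sg m,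
      (N m 0).map y.toMonoidHom = N m 0 ∧ (N m 1).map y.toMonoidHom = N m 1 ∧
      t ∈ powerTwists m e ∧ (N m 2).map c.toMonoidHom = N m 2 ∧
      K 2 = (((N m 2).map c.toMonoidHom).map t.toMonoidHom).map y.toMonoidHom

/-- **(N2) The normalisation is load-bearing at every `e ≥ 2`.** Witness: the RELABELLED standard triple
`K = N ∘ finRotate 3 = (N₁, N₂, N₀)` at `m = 0`: a factorisation `N₀ = K₂ = y t c N₂` with `y ∈ A ∩ B` gives
modulo `M_e` `y(N₂·M_e) = N₀·M_e = y(N₀·M_e)`, hence `N₂·M_e = N₀·M_e`, refuted by `bChar e`. [folklore] -/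
theorem not_withoutNormalisationAt {e : ℕ} (he : 2 ≤ e) : ¬ WithoutNormalisationAt 0 e := by
  intro h
  obtain ⟨y, t, c, hy0, _hy1, ht, hc, hK2⟩ := h rotatedKernels rotatedKernels_isGroupTrisection
  have hyM : (Me e).map y.toMonoidHom = Me e := (characteristic_iff_map_eq.1 (Me_characteristic e)) y
  have hrot : rotatedKernels 2 = N 0 0 := rfl
  have key : rotatedKernels 2 ⊔ Me e = (N 0 2 ⊔ Me e).map y.toMonoidHom :=
    sup_eq_map_of_factorisation (Me_characteristic e) (pow_mem_Me e) ht hc hK2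
  have key2 : (N 0 0 ⊔ Me e).map y.toMonoidHom = (N 0 2 ⊔ Me e).map y.toMonoidHom := by
    rw [← key, hrot, Subgroup.map_sup, hy0, hyM]
  have key3 : N 0 0 ⊔ Me e = N 0 2 ⊔ Me e := Subgroup.map_injective y.injective key2
  have hle : N 0 0 ⊔ Me e ≤ (bChar e).ker := sup_le (N0_le_ker_bChar e) (levelSubgroup_le_ker _)
  rw [key3] at hle
  have hb := hle (Subgroup.mem_sup_left b0_mem_N2)
  rw [MonoidHom.mem_ker, bChar_b0] at hb
  exact ofAdd_one_ne_one he hb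

/-- The gate at `(m,e)` WITHOUT the hypothesis `IsGroupTrisection`. [folklore] -/
def WithoutTrisectionAt (m e : ℕ) : Prop :=
  ∀ K : TrisectionKernels (3 + 3 * m), K 0 = N m 0 → K 1 = N m 1 →
    ∃ y t c : Sg m ≃* Sg m,
      (N m 0).map y.toMonoidHom = N m 0 ∧ (N m 1).map y.toMonoidHom = N m 1 ∧
      t ∈ powerTwists m e ∧ (N m 2).map c.toMonoidHom = N m 2 ∧
      K 2 = (((N m 2).map c.toMonoidHom).map t.toMonoidHom).map y.toMonoidHom

/-- **(N3) `IsGroupTrisection` is load-bearing at every `e`** (junk third kernel `K₂ = ⊥`). [folklore] -/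
theorem not_withoutTrisectionAt (e : ℕ) : ¬ WithoutTrisectionAt 0 e := by
  intro h
  obtain ⟨y, t, c, _hy0, _hy1, _ht, _hc, hK2⟩ := h ![s4Kernels 0, s4Kernels 1, ⊥] rfl rfl
  have hbot : (((N 0 2).map c.toMonoidHom).map t.toMonoidHom).map y.toMonoidHom = ⊥ := by
    rw [← hK2]; rfl
  rw [Subgroup.map_eq_bot_iff_of_injective _ y.injective,
    Subgroup.map_eq_bot_iff_of_injective _ t.injective,
    Subgroup.map_eq_bot_iff_of_injective _ c.injective] at hbot
  have hb : (SurfaceGroup.b 0 : Sg 0) ∈ N 0 2 := b0_mem_N2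
  rw [hbot, Subgroup.mem_bot] at hb
  have h1 := twistChar_b0 2
  rw [hb, map_one] at h1
  exact ofAdd_one_ne_one le_rfl h1.symm

/-- **(N8) Even the line's weaker FALLBACK gate** (the skeleton's `CongruenceGate`: `t` ANY `M`-congruent
automorphism) **needs the exact Goeritz factor**: its no-Goeritz-factor form is FALSE (same witness, level `M_2`).
[folklore] -/
theorem not_congruenceGateTrivialGoeritz :
    ¬ ∀ (m : ℕ) (K : TrisectionKernels (3 + 3 * m)),
        IsGroupTrisection (3 + 3 * m) (m + 1) (PUnit : Type) K → K 0 = N m 0 → K 1 = N m 1 →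
        ∀ M : Subgroup (Sg m), M.Characteristic → M.FiniteIndex →
        ∃ t c : Sg m ≃* Sg m,
          CongruentMod M t ∧ (N m 2).map c.toMonoidHom = N m 2 ∧
          K 2 = ((N m 2).map c.toMonoidHom).map t.toMonoidHom := by
  intro h
  haveI : Finite (Multiplicative (ZMod 2)) := inferInstance
  obtain ⟨t, c, ht, hc, hK2⟩ := h 0 twistedKernels twistedKernels_isGroupTrisection twistedKernels_zero
    twistedKernels_one (Me 2) (Me_characteristic 2) (levelSubgroup_finiteIndex 3 _)
  have key : twistedKernels 2 ⊔ Me 2 = N 0 2 ⊔ Me 2 := by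
    calc twistedKernels 2 ⊔ Me 2 = (N 0 2).map t.toMonoidHom ⊔ Me 2 := by rw [hK2, hc]
      _ = (N 0 2).map t.toMonoidHom ⊔ (Me 2).map t.toMonoidHom := by rw [map_eq_of_congruentMod _ t ht]
      _ = (N 0 2 ⊔ Me 2).map t.toMonoidHom := (Subgroup.map_sup _ _ _).symm
      _ = N 0 2 ⊔ Me 2 := map_sup_eq_of_congruentMod _ t ht _
  have hle : twistedKernels 2 ⊔ Me 2 ≤ (twistChar 2).ker :=
    sup_le (map_dehnZero_N2_le_ker_twistChar 2) (levelSubgroup_le_ker _)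
  rw [key] at hle
  have hb := hle (Subgroup.mem_sup_left b0_mem_N2)
  rw [MonoidHom.mem_ker, twistChar_b0] at hb
  exact ofAdd_one_ne_one le_rfl hb

/-! ### The `∀ m e` forms (the gen-1 statements) as corollaries -/

/-- No Goeritz factor at any `(m,e)`: false. [folklore] -/
theorem not_forall_trivialGoeritzAt : ¬ ∀ (m e : ℕ), 2 ≤ e → TrivialGoeritzAt m e :=
  fun h => not_trivialGoeritzAt le_rfl (h 0 2 le_rfl)

/-- No normalisation at any `(m,e)`: false. [folklore] -/
theorem not_forall_withoutNormalisationAt : ¬ ∀ (m e : ℕ), 2 ≤ e → WithoutNormalisationAt m e :=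
  fun h => not_withoutNormalisationAt le_rfl (h 0 2 le_rfl)

/-- No trisection hypothesis at any `(m,e)`: false. [folklore] -/
theorem not_forall_withoutTrisectionAt : ¬ ∀ (m e : ℕ), 2 ≤ e → WithoutTrisectionAt m e :=
  fun h => not_withoutTrisectionAt 2 (h 0 2 le_rfl)

/-! ## §6 Structure of the gate: the twist factor, `e = 0`, the factor `c`, `Inn S`, divisibility -/

/-- The gate at `m` with `t = 1`: `K₂ ∈ (A ∩ B) · C · N₂ = (A ∩ B) · N₂`. [folklore] -/
def TrivialTwistAt (m : ℕ) : Prop :=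
  ∀ K : TrisectionKernels (3 + 3 * m),
    IsGroupTrisection (3 + 3 * m) (m + 1) (PUnit : Type) K → K 0 = N m 0 → K 1 = N m 1 →
    ∃ y c : Sg m ≃* Sg m,
      (N m 0).map y.toMonoidHom = N m 0 ∧ (N m 1).map y.toMonoidHom = N m 1 ∧
      (N m 2).map c.toMonoidHom = N m 2 ∧
      K 2 = ((N m 2).map c.toMonoidHom).map y.toMonoidHom

/-- Unstable standardness of NORMALISED triples at `m` (over all `m`: `UnstableStandard` of `ShadowLevels.lean` given
the route item `WaldhausenPairs`; SPC4 ∧ balanced 4-d Waldhausen in AGK's dictionary — open). [folklore] -/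
def NormalisedUnstableStandardAt (m : ℕ) : Prop :=
  ∀ K : TrisectionKernels (3 + 3 * m),
    IsGroupTrisection (3 + 3 * m) (m + 1) (PUnit : Type) K → K 0 = N m 0 → K 1 = N m 1 →
    TrisectionKernels.Iso (N m) K

/-- **(N4)** without the power-twist slack the gate is exactly the normalised unstable gate. [folklore] -/
theorem trivialTwistAt_iff_normalisedUnstableStandardAt (m : ℕ) :
    TrivialTwistAt m ↔ NormalisedUnstableStandardAt m := by
  constructor
  · intro h K hK hK0 hK1
    obtain ⟨y, c, hy0, hy1, hc, hK2⟩ := h K hK hK0 hK1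
    refine ⟨y, fun i => ?_⟩
    fin_cases i
    · exact hy0.trans hK0.symm
    · exact hy1.trans hK1.symm
    · change (N m 2).map y.toMonoidHom = K 2
      rw [hK2, hc]
  · intro h K hK hK0 hK1
    obtain ⟨α, hα⟩ := h K hK hK0 hK1
    refine ⟨α, MulEquiv.refl _, ?_, ?_, ?_, ?_⟩
    · rw [hα 0, hK0]
    · rw [hα 1, hK1]
    · exact Subgroup.map_id _
    · change K 2 = ((N m 2).map (MonoidHom.id _)).map α.toMonoidHom
      rw [Subgroup.map_id, hα 2]

/-- **Sandwich, upper slice**: `NormalisedUnstableStandardAt m → GateAt m e` for every `e`. Hence every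
counterexample to the gate at any `(m,e)` is a normalised balanced group trisection of `{1}` not isomorphic to the
standard one — an exotic homotopy 4-sphere or a non-standard balanced trisection of `S⁴`. [folklore] -/
theorem gateAt_of_normalisedUnstableStandardAt {m : ℕ} (h : NormalisedUnstableStandardAt m) (e : ℕ) :
    GateAt m e := by
  intro K hK hK0 hK1
  obtain ⟨y, c, hy0, hy1, hc, hK2⟩ := (trivialTwistAt_iff_normalisedUnstableStandardAt m).2 h K hK hK0 hK1
  refine ⟨y, 1, c, hy0, hy1, Subgroup.one_mem _, hc, ?_⟩
  rw [hK2]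
  congr 1
  change _ = ((N m 2).map c.toMonoidHom).map (MonoidHom.id _)
  rw [Subgroup.map_id]

/-- **(N5)** at `e = 0` the power subgroup is trivial (so `GateAt m 0 ↔` the normalised unstable gate at
`m`; this is why the stub asks `2 ≤ e` — at `e = 1` it contains every based Dehn twist). [folklore] -/
theorem powerTwists_zero (m : ℕ) : powerTwists m 0 = ⊥ := by
  rw [eq_bot_iff]
  refine Subgroup.normalClosure_le_normal ?_
  rintro _ ⟨T, _, rfl⟩
  simp

/-- The gate at `(m,e)` without the factor `c`. [folklore] -/
def NoHandlebodyFactorAt (m e : ℕ) : Prop :=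
  ∀ K : TrisectionKernels (3 + 3 * m),
    IsGroupTrisection (3 + 3 * m) (m + 1) (PUnit : Type) K → K 0 = N m 0 → K 1 = N m 1 →
    ∃ y t : Sg m ≃* Sg m,
      (N m 0).map y.toMonoidHom = N m 0 ∧ (N m 1).map y.toMonoidHom = N m 1 ∧
      t ∈ powerTwists m e ∧ K 2 = ((N m 2).map t.toMonoidHom).map y.toMonoidHom

/-- **(N6)** the handlebody factor `c` is decoration: `GateAt m e ↔` the same statement with `c = 1`
(`K₂ ∈ (A∩B)·Mod_g[e]·N₂`). [folklore] -/
theorem gateAt_iff_noHandlebodyFactorAt (m e : ℕ) : GateAt m e ↔ NoHandlebodyFactorAt m e := by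
  constructor
  · intro h K hK hK0 hK1
    obtain ⟨y, t, c, hy0, hy1, ht, hc, hK2⟩ := h K hK hK0 hK1
    exact ⟨y, t, hy0, hy1, ht, by rw [hK2, hc]⟩
  · intro h K hK hK0 hK1
    obtain ⟨y, t, hy0, hy1, ht, hK2⟩ := h K hK hK0 hK1
    refine ⟨y, t, MulEquiv.refl _, hy0, hy1, ht, Subgroup.map_id _, ?_⟩
    rw [hK2]
    congr 2
    exact (Subgroup.map_id _).symm

/-- [folklore] -/
theorem map_conj_eq_of_normal {m : ℕ} (H : Subgroup (Sg m)) [H.Normal] (s : Sg m) :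
    H.map (MulAut.conj s).toMonoidHom = H := by
  apply le_antisymm
  · rintro _ ⟨x, hx, rfl⟩
    exact Subgroup.Normal.conj_mem inferInstance x hx s
  · intro x hx
    refine ⟨s⁻¹ * x * s⁻¹⁻¹, Subgroup.Normal.conj_mem inferInstance x hx s⁻¹, ?_⟩
    simp [MulAut.conj_apply, mul_assoc]

/-- **(N7)** every inner automorphism stabilises all three standard kernels: the gate is a statement in
`Out S = Mod^±_g`, where `powerTwists m e` maps onto Funar's `Mod_g[e]`. [folklore] -/
theorem inner_mem_stabilisers (m : ℕ) (s : Sg m) (i : Fin 3) :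
    (N m i).map (MulAut.conj s).toMonoidHom = N m i := by
  haveI : (N m i).Normal := (stabilizeIter_isGroupTrisection m).normal i
  exact map_conj_eq_of_normal _ s

end Summit.SmoothPoincare4.SmoothPoincare4.Theorems.ShadowsStandard.Negative.PowerTwist

end
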